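import Mathlib
import Summits.BirchSwinnertonDyer.Rank1Residual.ManinAdditive.TwoEisensteinRankOneLaws
import Summits.BirchSwinnertonDyer.BirchSwinnertonDyer.Theorems.ManinLocalTwoThreeFittingMulti
import Summits.ABC.ABC.Theorems.IsogenyGlueCongruenceTorsionSharingPrimeBoundLatticeBasis
import Literature.NumberTheory.EllipticCurves.PastenSpectralDegreeProofs
import HarnessLib

/-!
# The mod-`2` decomposition of `S₂(Γ₀(N); ℤ)` under a 2-Eisenstein LINE (toward E-imc-87 `RankOneForcesOddCongruence`)

Summit `BirchSwinnertonDyer`, route `ManinLocalTwoThree` (cell bsd-f2-manin), deciding crux C2 `ManinOddAtFour`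
(stmt-BirchSwinnertonDyer-22967), IMC lens (imc g15/g16, MEMO-imc §21–§22; typed leaf `…ManinAdditive.TwoEisensteinRankOneLaws`).

PROVED HERE.  Let `L = S₂(Γ₀(N); ℤ)` and suppose the 2-Eisenstein-nilpotent integral forms (`IsTwoEisensteinNilpotent`:
some power of every `T_ℓ`, `ℓ ∤ N` an odd prime, maps the form into `2L`) form a LINE through `f` modulo `2`
(`∀ g nilpotent, g ∈ 2L ∨ g − f ∈ 2L` — the shape of the law E-imc-85 `FourPTwoEisensteinRankOne` at its generator).
Then EVERY integral form decomposes as `g = ε f + y + 2k` with `ε ∈ ℤ`, `k ∈ L` and `y` a finite sum of forms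
`T_ℓ z`, `z ∈ L` (`integral_decomp_of_twoEisensteinLine`).  Proof: `L` is a finitely generated free `ℤ`-module (a
lattice basis, tree `Summit.ABC.ABC.Theorems.IGCTorsionSharing.exists_latticeBasis_integralCuspForms0`), so `L/2L` is a
FINITE module on which the `T_ℓ` act as a commuting family (`heckeT_mem_integralCuspForms0`, `heckeT_comm_gamma0_holds`);
the multi-operator Fitting lemma (`top_le_iInf_iSup_ker_pow_sup_iSup_range`, sibling file `…FittingMulti`) writes
`L/2L = (⋂_ℓ ⨆ₙ ker T̄_ℓⁿ) + Σ_ℓ T̄_ℓ(L/2L)`; an element of the first summand lifts to a NILPOTENT integral form, hence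
to `ℤ f + 2L` by the line hypothesis, and an element of the second lifts to `Σ_ℓ T_ℓ(L) + 2L`.
Nothing about BSD, Manin's conjecture or any Manin constant is asserted or proved here.
-/

-- `Summit.BirchSwinnertonDyer.BirchSwinnertonDyer` is the mandated summit-side namespace (single-conjunct summit).
set_option linter.dupNamespace false

noncomputable section

open scoped MatrixGroups ModularForm
open CongruenceSubgroup UpperHalfPlane
open Literature.NumberTheory.EllipticCurves Literature.NumberTheory.EllipticCurves.ModularForms
open Summit.BirchSwinnertonDyer.Rank1Residual.ManinAdditive.TwoEisenstein

namespace Summit.BirchSwinnertonDyer.BirchSwinnertonDyer.Theorems.ManinLocalTwoThree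

variable {N : ℕ} [NeZero N]

/-- Powers of the `ℤ`-linear restriction of a `ℂ`-linear endomorphism to a stable subgroup agree with the powers of
the endomorphism on the underlying vectors. [folklore] -/
theorem coe_restrict_restrictScalars_pow_apply {V : Type*} [AddCommGroup V] [Module ℂ V] (T : Module.End ℂ V)
    {L : Submodule ℤ V} (h : ∀ x ∈ L, (T.restrictScalars ℤ) x ∈ L) (n : ℕ) (x : L) :
    ((((T.restrictScalars ℤ).restrict h) ^ n) x : V) = (T ^ n) (x : V) := by
  induction n generalizing x with
  | zero => simp
  | succ n ih =>
    rw [pow_succ, Module.End.mul_apply, ih, pow_succ, Module.End.mul_apply, LinearMap.coe_restrict_apply,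
      LinearMap.coe_restrictScalars]

/-- `S₂(Γ₀(N); ℤ)` is a finitely generated `ℤ`-module (it has a lattice basis — Shimura 1971, Thm. 3.52; tree
`exists_latticeBasis_integralCuspForms0`). [cite: Shimura1971, Thm. 3.52] -/
theorem moduleFinite_integralCuspForms0 : Module.Finite ℤ (integralCuspForms0 N 2) := by
  obtain ⟨d, b, hbL, hrepr⟩ :=
    Summit.ABC.ABC.Theorems.IGCTorsionSharing.exists_latticeBasis_integralCuspForms0 N 2 le_rfl
  rw [Module.Finite.iff_fg, Submodule.fg_def]
  refine ⟨Set.range b, Set.finite_range b, le_antisymm (Submodule.span_le.mpr ?_) fun v hv ↦ ?_⟩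
  · rintro _ ⟨i, rfl⟩
    exact hbL i
  · choose z hz using hrepr v hv
    rw [← b.sum_repr v]
    refine Submodule.sum_mem _ fun i _ ↦ ?_
    rw [hz i, Int.cast_smul_eq_zsmul]
    exact Submodule.smul_mem _ _ (Submodule.subset_span ⟨i, rfl⟩)

/-- **The mod-`2` decomposition of `S₂(Γ₀(N); ℤ)` under a 2-Eisenstein line.**  If every 2-Eisenstein-nilpotent
integral form is `≡ 0` or `≡ f (mod 2)`, then every `g ∈ S₂(Γ₀(N); ℤ)` is `ε • f + y + 2 • k` with `ε ∈ ℤ`,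
`k ∈ S₂(Γ₀(N); ℤ)` and `y` in the span of the `T_ℓ(S₂(Γ₀(N); ℤ))`, `ℓ ∤ N` odd primes (multi-operator Fitting lemma on
the finite module `S₂(ℤ)/2` plus the line hypothesis; see the module docstring). [folklore] -/
theorem integral_decomp_of_twoEisensteinLine (f : CuspForm (Gamma0 N) 2)
    (hline : ∀ g : CuspForm (Gamma0 N) 2, IsTwoEisensteinNilpotent N g →
      IsTwiceIntegral N g ∨ IsTwiceIntegral N (g - f))
    {g : CuspForm (Gamma0 N) 2} (hg : g ∈ integralCuspForms0 N 2) :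
    ∃ (ε : ℤ) (y : CuspForm (Gamma0 N) 2),
      y ∈ (⨆ ℓ : {ℓ : ℕ // ℓ.Prime ∧ Odd ℓ ∧ ¬ ℓ ∣ N},
        (integralCuspForms0 N 2).map
          ((haveI : NeZero ℓ.1 := ⟨ℓ.2.1.ne_zero⟩; heckeT (Gamma0 N) 2 ℓ.1).restrictScalars ℤ)) ∧
      IsTwiceIntegral N (g - ε • f - y) := by
  classical
  -- the lattice `L = S₂(ℤ)`, its double `2L`, and the finite module `L/2L`
  set L : Submodule ℤ (CuspForm (Gamma0 N) 2) := integralCuspForms0 N 2 with hL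
  haveI : Module.Finite ℤ L := moduleFinite_integralCuspForms0
  set D2 : Submodule ℤ L := LinearMap.range (LinearMap.lsmul ℤ L 2) with hD2
  have hD2mem : ∀ x : L, x ∈ D2 ↔ ∃ y : L, (2 : ℤ) • y = x := fun x ↦ by
    simp only [hD2, LinearMap.mem_range, LinearMap.lsmul_apply]
  haveI : Module.Finite ℤ (L ⧸ D2) := Module.Finite.of_surjective D2.mkQ D2.mkQ_surjective
  have htors : Module.IsTorsion ℤ (L ⧸ D2) := by
    intro q
    obtain ⟨x, rfl⟩ := D2.mkQ_surjective q
    refine ⟨⟨2, mem_nonZeroDivisors_of_ne_zero two_ne_zero⟩, ?_⟩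
    change (2 : ℤ) • D2.mkQ x = 0
    rw [← map_zsmul, Submodule.mkQ_apply, Submodule.Quotient.mk_eq_zero]
    exact (hD2mem _).mpr ⟨x, rfl⟩
  haveI : Finite (L ⧸ D2) := Module.finite_of_fg_torsion (L ⧸ D2) htors
  haveI : IsArtinian ℤ (L ⧸ D2) := isArtinian_of_finite
  haveI : IsNoetherian ℤ (L ⧸ D2) := isNoetherian_of_finite ℤ _
  -- the odd primes away from the level and their Hecke operators on `L` and on `L/2L`
  let P : Type := {ℓ : ℕ // ℓ.Prime ∧ Odd ℓ ∧ ¬ ℓ ∣ N}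
  haveI hP0 : ∀ ℓ : P, NeZero (ℓ.1 : ℕ) := fun ℓ ↦ ⟨ℓ.2.1.ne_zero⟩
  let T : P → Module.End ℂ (CuspForm (Gamma0 N) 2) := fun ℓ ↦ heckeT (Gamma0 N) 2 ℓ.1
  have hT : ∀ ℓ : P, T ℓ = heckeT (Gamma0 N) 2 ℓ.1 := fun ℓ ↦ rfl
  have hTL : ∀ ℓ : P, ∀ x ∈ L, ((T ℓ).restrictScalars ℤ) x ∈ L := fun ℓ x hx ↦ by
    rw [LinearMap.coe_restrictScalars, hT]
    exact heckeT_mem_integralCuspForms0 ℓ.1 ℓ.2.1 ℓ.2.2.2 hx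
  let TL : P → Module.End ℤ L := fun ℓ ↦ ((T ℓ).restrictScalars ℤ).restrict (hTL ℓ)
  have hTLcoe : ∀ (ℓ : P) (x : L), ((TL ℓ x : L) : CuspForm (Gamma0 N) 2) = T ℓ x := fun ℓ x ↦ by
    rw [LinearMap.coe_restrict_apply, LinearMap.coe_restrictScalars]
  have hTLD2 : ∀ ℓ : P, D2 ≤ D2.comap (TL ℓ) := fun ℓ x hx ↦ by
    obtain ⟨y, rfl⟩ := (hD2mem x).mp hx
    rw [Submodule.mem_comap, map_zsmul]
    exact (hD2mem _).mpr ⟨TL ℓ y, rfl⟩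
  let A : P → Module.End ℤ (L ⧸ D2) := fun ℓ ↦ D2.mapQ D2 (TL ℓ) (hTLD2 ℓ)
  have hAmk : ∀ (ℓ : P) (x : L), A ℓ (D2.mkQ x) = D2.mkQ (TL ℓ x) := fun ℓ x ↦ rfl
  have hAmk_pow : ∀ (ℓ : P) (n : ℕ) (x : L), (A ℓ ^ n) (D2.mkQ x) = D2.mkQ ((TL ℓ ^ n) x) := by
    intro ℓ n
    induction n with
    | zero => intro x; simp
    | succ n ih => intro x; rw [pow_succ, Module.End.mul_apply, hAmk, ih, pow_succ, Module.End.mul_apply]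
  have two_smul_eq : ∀ v : CuspForm (Gamma0 N) 2, (2 : ℂ) • v = (2 : ℤ) • v := fun v ↦ by
    rw [← Int.cast_smul_eq_zsmul ℂ (2 : ℤ) v, Int.cast_ofNat]
  have hTLcomm : ∀ (ℓ ℓ' : P) (x : L), TL ℓ (TL ℓ' x) = TL ℓ' (TL ℓ x) := fun ℓ ℓ' x ↦ by
    apply Subtype.ext
    rw [hTLcoe, hTLcoe, hTLcoe, hTLcoe, hT, hT, ← Module.End.mul_apply, heckeT_comm_gamma0_holds N 2 ℓ.1 ℓ'.1,
      Module.End.mul_apply]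
  have hA : ∀ ℓ ℓ' : P, Commute (A ℓ) (A ℓ') := by
    intro ℓ ℓ'
    refine LinearMap.ext fun q ↦ ?_
    obtain ⟨x, rfl⟩ := D2.mkQ_surjective q
    rw [Module.End.mul_apply, Module.End.mul_apply, hAmk, hAmk, hAmk, hAmk, hTLcomm]
  -- multi-operator Fitting: `L/2L = (⋂ ⨆ₙ ker A_ℓⁿ) + Σ range A_ℓ`
  have htop := top_le_iInf_iSup_ker_pow_sup_iSup_range A hA (Submodule.mem_top (x := D2.mkQ ⟨g, hg⟩))
  obtain ⟨u, hu, w, hw, huw⟩ := Submodule.mem_sup.mp htop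
  -- the generalized-kernel component lifts to a nilpotent form, hence into `ℤ f + 2L`
  obtain ⟨x, rfl⟩ := D2.mkQ_surjective u
  have hxnil : IsTwoEisensteinNilpotent N (x : CuspForm (Gamma0 N) 2) := by
    refine ⟨x.2, fun ℓ hℓ hodd hℓN ↦ ?_⟩
    have hxℓ := (Submodule.mem_iInf _).mp hu ⟨ℓ, hℓ, hodd, hℓN⟩
    obtain ⟨n, hn⟩ := (mem_iSup_ker_pow_iff _ _).mp hxℓ
    have hn' : D2.mkQ ((TL ⟨ℓ, hℓ, hodd, hℓN⟩ ^ n) x) = 0 := by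
      rw [← hAmk_pow]
      exact hn
    rw [Submodule.mkQ_apply, Submodule.Quotient.mk_eq_zero] at hn'
    obtain ⟨y, hy⟩ := (hD2mem _).mp hn'
    refine ⟨n, y, y.2, ?_⟩
    have hcoe := congrArg (fun z : L ↦ (z : CuspForm (Gamma0 N) 2)) hy
    rw [Submodule.coe_smul_of_tower, coe_restrict_restrictScalars_pow_apply] at hcoe
    rw [← hcoe, two_smul_eq]
  -- the range component lifts into `Σ_ℓ T_ℓ(L)`
  have hwlift : ∀ w' ∈ (⨆ ℓ : P, LinearMap.range (A ℓ)), ∃ y : L,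
      (y : CuspForm (Gamma0 N) 2) ∈ (⨆ ℓ : P, L.map ((T ℓ).restrictScalars ℤ)) ∧ D2.mkQ y = w' := by
    intro w' hw'
    refine Submodule.iSup_induction (fun ℓ : P ↦ LinearMap.range (A ℓ))
      (motive := fun w' ↦ ∃ y : L, (y : CuspForm (Gamma0 N) 2) ∈ (⨆ ℓ : P, L.map ((T ℓ).restrictScalars ℤ)) ∧
        D2.mkQ y = w') hw' ?_ ⟨0, by simp⟩ ?_
    · intro ℓ w' hw'
      obtain ⟨q, rfl⟩ := LinearMap.mem_range.mp hw'
      obtain ⟨z, rfl⟩ := D2.mkQ_surjective q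
      refine ⟨TL ℓ z, ?_, (hAmk ℓ z).symm⟩
      refine Submodule.mem_iSup_of_mem ℓ ?_
      rw [hTLcoe]
      exact Submodule.mem_map_of_mem z.2
    · rintro w₁ w₂ ⟨y₁, hy₁, rfl⟩ ⟨y₂, hy₂, rfl⟩
      exact ⟨y₁ + y₂, by rw [Submodule.coe_add]; exact add_mem hy₁ hy₂, by rw [map_add]⟩
  obtain ⟨y, hy, rfl⟩ := hwlift w hw
  -- `g - x - y ∈ 2L`
  have hk : D2.mkQ (⟨g, hg⟩ - x - y) = 0 := by
    rw [map_sub, map_sub, ← huw, add_sub_cancel_left, sub_self]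
  rw [Submodule.mkQ_apply, Submodule.Quotient.mk_eq_zero] at hk
  obtain ⟨k, hk⟩ := (hD2mem _).mp hk
  have hkcoe := congrArg (fun z : L ↦ (z : CuspForm (Gamma0 N) 2)) hk
  simp only [Submodule.coe_smul_of_tower, Submodule.coe_sub] at hkcoe
  -- conclude by the line hypothesis on `x`
  rcases hline _ hxnil with ⟨h, hh, hxh⟩ | ⟨h, hh, hxh⟩
  · refine ⟨0, y, hy, k + h, add_mem k.2 hh, ?_⟩
    rw [zero_smul, sub_zero, smul_add, ← hxh, two_smul_eq, hkcoe]
    abel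
  · refine ⟨1, y, hy, k + h, add_mem k.2 hh, ?_⟩
    rw [one_smul, smul_add, ← hxh, two_smul_eq, hkcoe]
    abel

end Summit.BirchSwinnertonDyer.BirchSwinnertonDyer.Theorems.ManinLocalTwoThree

end
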